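import Summits.HubbardSuperconductivity.HubbardSuperconductivity.Theorems.NodalDiracTwistDiskTrivialHolonomy

/-!
# Route `NodalDiracTwist` — crux `NodalDiracWeakCoupling`, line `birth`: `stub_moebiusModel`

Helper file for stmt-HubbardSuperconductivity-10370 (`NodalDiracWeakCoupling`): the stub
`stub_moebiusModel` of the line `birth`. The abstract Longuet-Higgins theorem
(`stub_moebiusAbstract`, taken verbatim as the hypothesis `habs`) is instantiated for the
spin-twisted Hubbard torus `H_L(U, φ) = spinTwistedHubbardTorus L U φ` on the sector
`K = szSector N 0` (a coordinate sector, `mem_szSector_zero_iff_coord`, so `sector_groundState`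
gives existence of sector ground states and the variational bound; an EMPTY sector has no ground
state and the two-fold hypothesis is absurd). The model inputs proved here, as standalone lemmas:
* the FORM BOUND `|⟨x, R w⟩| ≤ |ι|² · max |R_{st}|` for unit `x, w`
  (`norm_star_dotProduct_mulVec_le_card_sq`);
* the FIRST-ORDER DATA at a twist `p`: `φ ↦ H_L(U, φ)` is differentiable (entries are
  trigonometric polynomials `Σ c e^{± i (-1)^σ φ_μ / L}`), so with `V μ = ∂_μ H_L(U, ·)(p)` the
  Taylor remainder `H(p + y) - H(p) - Σ_μ y_μ V μ` is `o(|y|)` in the sesquilinear-form sense and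
  the forms of `V μ` are bounded (`firstOrder_of_hasFDerivAt`, `spinTwistedHubbardTorus_firstOrder`);
* the antiunitary symmetry `T v = F v̄`, `F = fockRelabel Orb.spinSwap` the spin-exchange unitary,
  is an INVOLUTION: `F` is a real signed permutation matrix (`fockRelabel_map_star`) and `F² = 1`
  since `spinSwap² = id` and `fockRelabel` is multiplicative
  (`fockRelabel_spinSwap_mulVec_star_mulVec_star`); conjugate-linearity, sector preservation,
  commutation with `H_L(U, φ)` and norm preservation are those of `diskTrivialHolonomy_twisted`.

Sources: Y. Hatsugai, J. Phys. Soc. Jpn. 75 (2006) 123601 (quantised Berry phases from an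
antiunitary symmetry); E. H. Lieb, PRL 62 (1989) 1201 (the model and its `S^z` sectors);
H. C. Longuet-Higgins, Proc. R. Soc. Lond. A 344 (1975) 147. No new definitions.
-/

-- the mandated namespace `Summit.<Summit>.<Problem>.Theorems` repeats `HubbardSuperconductivity`
-- (single-problem summit, D-0017), which the `dupNamespace` linter flags on every declaration
set_option linter.dupNamespace false

noncomputable section

namespace Summit.HubbardSuperconductivity.HubbardSuperconductivity.Theorems.NodalDiracTwist

open Matrix Complex Literature.MathematicalPhysics.QuantumLattice HubbardWave0
open scoped ComplexOrder

/-! ### The sesquilinear form of a matrix with bounded entries -/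

section FormBound

variable {ι : Type*} [Fintype ι]

/-- **Form bound from an entry bound**: if every entry of `R` has norm `≤ M`, then for unit
vectors `x, w` (`⟨x, x⟩ = ⟨w, w⟩ = 1`) `|⟨x, R w⟩| ≤ |ι|² M` (coordinates of unit vectors are
bounded by `1`). [folklore] -/
theorem norm_star_dotProduct_mulVec_le_card_sq {R : Matrix ι ι ℂ} {M : ℝ}
    (hR : ∀ s t, ‖R s t‖ ≤ M) {x w : ι → ℂ} (hx : star x ⬝ᵥ x = 1) (hw : star w ⬝ᵥ w = 1) :
    ‖star x ⬝ᵥ (R *ᵥ w)‖ ≤ (Fintype.card ι : ℝ) ^ 2 * M := by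
  have hx1 := norm_apply_le_one_of_unit hx
  have hw1 := norm_apply_le_one_of_unit hw
  have hRw : ∀ s, ‖(R *ᵥ w) s‖ ≤ Fintype.card ι * M := fun s => by
    calc ‖(R *ᵥ w) s‖ = ‖∑ t, R s t * w t‖ := rfl
      _ ≤ ∑ t, ‖R s t * w t‖ := norm_sum_le _ _
      _ ≤ ∑ _t : ι, M := Finset.sum_le_sum fun t _ => by
          rw [norm_mul]
          calc ‖R s t‖ * ‖w t‖ ≤ ‖R s t‖ * 1 :=
                mul_le_mul_of_nonneg_left (hw1 t) (norm_nonneg _)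
            _ ≤ M := by rw [mul_one]; exact hR s t
      _ = Fintype.card ι * M := by rw [Finset.sum_const, Finset.card_univ, nsmul_eq_mul]
  calc ‖star x ⬝ᵥ (R *ᵥ w)‖ = ‖∑ s, star (x s) * (R *ᵥ w) s‖ := rfl
    _ ≤ ∑ s, ‖star (x s) * (R *ᵥ w) s‖ := norm_sum_le _ _
    _ ≤ ∑ _s : ι, (Fintype.card ι : ℝ) * M := Finset.sum_le_sum fun s _ => by
        rw [norm_mul, norm_star]
        calc ‖x s‖ * ‖(R *ᵥ w) s‖ ≤ ‖(R *ᵥ w) s‖ :=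
              mul_le_of_le_one_left (norm_nonneg _) (hx1 s)
          _ ≤ _ := hRw s
    _ = (Fintype.card ι : ℝ) ^ 2 * M := by
        rw [Finset.sum_const, Finset.card_univ, nsmul_eq_mul]
        ring

end FormBound

/-! ### First-order data from a Fréchet derivative (entrywise sup norm on matrices) -/

section FirstOrder

open scoped Matrix.Norms.Elementwise

variable {ι : Type*} [Fintype ι]

/-- The sup norm of `y ∈ ℝ²` is bounded by its Euclidean norm `√(y₀² + y₁²)`. [folklore] -/
theorem pi_norm_le_sqrt_sq_add_sq (y : Fin 2 → ℝ) : ‖y‖ ≤ Real.sqrt (y 0 ^ 2 + y 1 ^ 2) := by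
  refine (pi_norm_le_iff_of_nonneg (Real.sqrt_nonneg _)).2 ?_
  rw [Fin.forall_fin_two, Real.norm_eq_abs, Real.norm_eq_abs]
  exact ⟨Real.abs_le_sqrt (by nlinarith [sq_nonneg (y 1)]),
    Real.abs_le_sqrt (by nlinarith [sq_nonneg (y 0)])⟩

omit [Fintype ι] in
/-- A real scalar acts on complex matrices as the corresponding complex scalar. [folklore] -/
theorem ofReal_smul_matrix (r : ℝ) (M : Matrix ι ι ℂ) : ((r : ℂ)) • M = r • M := by
  ext s t
  rw [Matrix.smul_apply, Matrix.smul_apply, smul_eq_mul, Complex.real_smul]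

/-- **First-order data of a differentiable matrix family at a point.** If `φ ↦ H φ`
(`φ ∈ ℝ²`, entrywise sup norm) has Fréchet derivative `D` at `p`, then with
`V μ = D e_μ = ∂_μ H (p)` the sesquilinear forms of `V μ` between unit vectors are bounded, and
the Taylor remainder `H (p + y) - H p - (y₀ V 0 + y₁ V 1)` has forms `≤ ε |y|` between unit
vectors for `|y| ≤ δ(ε)` (`|y| = √(y₀² + y₁²)`): the little-`o` of `HasFDerivAt`, passed from the
sup norm of the entries to the forms by `norm_star_dotProduct_mulVec_le_card_sq`. [folklore] -/
theorem firstOrder_of_hasFDerivAt (H : (Fin 2 → ℝ) → Matrix ι ι ℂ) (p : Fin 2 → ℝ)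
    (D : (Fin 2 → ℝ) →L[ℝ] Matrix ι ι ℂ) (hD : HasFDerivAt H D p) :
    ∃ (V : Fin 2 → Matrix ι ι ℂ) (C : ℝ),
      (∀ (μ : Fin 2) (x w : ι → ℂ), star x ⬝ᵥ x = 1 → star w ⬝ᵥ w = 1 →
        ‖star x ⬝ᵥ (V μ *ᵥ w)‖ ≤ C) ∧
      (∀ ε : ℝ, 0 < ε → ∃ δ : ℝ, 0 < δ ∧ ∀ y : Fin 2 → ℝ,
        Real.sqrt (y 0 ^ 2 + y 1 ^ 2) ≤ δ → ∀ x w : ι → ℂ, star x ⬝ᵥ x = 1 → star w ⬝ᵥ w = 1 →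
          ‖star x ⬝ᵥ ((H (fun ν => p ν + y ν) - H p -
              (((y 0 : ℝ) : ℂ) • V 0 + ((y 1 : ℝ) : ℂ) • V 1)) *ᵥ w)‖ ≤
            ε * Real.sqrt (y 0 ^ 2 + y 1 ^ 2)) := by
  set V : Fin 2 → Matrix ι ι ℂ := fun μ => D (Pi.single μ 1) with hV
  refine ⟨V, (Fintype.card ι : ℝ) ^ 2 * (‖V 0‖ + ‖V 1‖), ?_, ?_⟩
  · intro μ x w hx hw
    refine norm_star_dotProduct_mulVec_le_card_sq (fun s t => ?_) hx hw
    refine (Matrix.norm_entry_le_entrywise_sup_norm (V μ)).trans ?_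
    fin_cases μ
    · exact le_add_of_nonneg_right (norm_nonneg _)
    · exact le_add_of_nonneg_left (norm_nonneg _)
  · intro ε hε
    set c : ℝ := ε / ((Fintype.card ι : ℝ) ^ 2 + 1) with hc
    have hc0 : 0 < c := div_pos hε (by positivity)
    have hcε : (Fintype.card ι : ℝ) ^ 2 * c ≤ ε := by
      rw [hc, mul_div_assoc', div_le_iff₀ (by positivity)]
      nlinarith [hε.le]
    obtain ⟨δ', hδ', hball⟩ :=
      Metric.eventually_nhds_iff.1 ((hasFDerivAt_iff_isLittleO_nhds_zero.1 hD).def hc0)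
    refine ⟨δ' / 2, half_pos hδ', fun y hy x w hx hw => ?_⟩
    have hy' : ‖y‖ ≤ Real.sqrt (y 0 ^ 2 + y 1 ^ 2) := pi_norm_le_sqrt_sq_add_sq y
    have hdist : dist y 0 < δ' := by
      rw [dist_zero_right]
      linarith
    have hR : ‖H (p + y) - H p - D y‖ ≤ c * ‖y‖ := hball hdist
    have hDy : D y = ((y 0 : ℝ) : ℂ) • V 0 + ((y 1 : ℝ) : ℂ) • V 1 := by
      have hy2 : y = y 0 • (Pi.single 0 1 : Fin 2 → ℝ) + y 1 • (Pi.single 1 1 : Fin 2 → ℝ) := by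
        ext i
        fin_cases i <;> simp
      conv_lhs => rw [hy2]
      rw [map_add, map_smul, map_smul, ofReal_smul_matrix, ofReal_smul_matrix]
    have hfun : (fun ν => p ν + y ν) = p + y := rfl
    rw [hfun, ← hDy]
    calc ‖star x ⬝ᵥ ((H (p + y) - H p - D y) *ᵥ w)‖
        ≤ (Fintype.card ι : ℝ) ^ 2 * ‖H (p + y) - H p - D y‖ :=
          norm_star_dotProduct_mulVec_le_card_sq
            (fun s t => Matrix.norm_entry_le_entrywise_sup_norm _) hx hw
      _ ≤ (Fintype.card ι : ℝ) ^ 2 * (c * Real.sqrt (y 0 ^ 2 + y 1 ^ 2)) := by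
          gcongr
          exact hR.trans (mul_le_mul_of_nonneg_left hy' hc0.le)
      _ ≤ ε * Real.sqrt (y 0 ^ 2 + y 1 ^ 2) := by
          rw [← mul_assoc]
          exact mul_le_mul_of_nonneg_right hcε (Real.sqrt_nonneg _)

end FirstOrder

/-! ### The spin-twisted torus: differentiability and first-order data -/

section Twisted

open scoped Matrix.Norms.Elementwise

variable (L : ℕ) [NeZero L]

/-- `φ ↦ H_L(U, φ)` is differentiable (finite sums of `e^{±iθ(φ)}`, `θ` linear in `φ`, times
fixed matrices). [folklore] -/
theorem differentiable_spinTwistedHubbardTorus (U : ℝ) :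
    Differentiable ℝ fun φ : Fin 2 → ℝ => spinTwistedHubbardTorus L U φ := by
  unfold spinTwistedHubbardTorus spinTwistedHopping
  fun_prop

/-- **First-order data of the spin-twisted Hubbard torus at a twist `p`**: there are matrices
`V μ = ∂H_L(U, ·)/∂φ_μ (p)` with bounded forms between unit vectors and a Taylor bound
`|⟨x, (H(p + y) - H(p) - y₀ V 0 - y₁ V 1) w⟩| ≤ ε |y|` for unit `x, w` and `|y| ≤ δ(ε)` — the
hypotheses `hCV`, `hTaylor` of the abstract Longuet-Higgins theorem. Hatsugai, J. Phys. Soc.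
Jpn. 75 (2006) 123601; Lieb, PRL 62 (1989) 1201. [folklore] -/
theorem spinTwistedHubbardTorus_firstOrder (U : ℝ) (p : Fin 2 → ℝ) :
    ∃ (V : Fin 2 → Matrix (Finset (Orb (FermionTorus 2 L))) (Finset (Orb (FermionTorus 2 L))) ℂ)
      (C : ℝ),
      (∀ (μ : Fin 2) (x w : Fock (Orb (FermionTorus 2 L))), star x ⬝ᵥ x = 1 → star w ⬝ᵥ w = 1 →
        ‖star x ⬝ᵥ (V μ *ᵥ w)‖ ≤ C) ∧
      (∀ ε : ℝ, 0 < ε → ∃ δ : ℝ, 0 < δ ∧ ∀ y : Fin 2 → ℝ,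
        Real.sqrt (y 0 ^ 2 + y 1 ^ 2) ≤ δ → ∀ x w : Fock (Orb (FermionTorus 2 L)),
          star x ⬝ᵥ x = 1 → star w ⬝ᵥ w = 1 →
          ‖star x ⬝ᵥ ((spinTwistedHubbardTorus L U (fun ν => p ν + y ν) -
              spinTwistedHubbardTorus L U p -
              (((y 0 : ℝ) : ℂ) • V 0 + ((y 1 : ℝ) : ℂ) • V 1)) *ᵥ w)‖ ≤
            ε * Real.sqrt (y 0 ^ 2 + y 1 ^ 2)) :=
  firstOrder_of_hasFDerivAt (spinTwistedHubbardTorus L U) p _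
    ((differentiable_spinTwistedHubbardTorus L U) p).hasFDerivAt

end Twisted

/-! ### The antiunitary symmetry `T = F ∘ K` is an involution -/

section Involution

variable {ι : Type*} [LinearOrder ι] [Fintype ι]

/-- `U_π = fockRelabel π` is a REAL matrix (entries `0`, `±1`): entrywise conjugation fixes it.
Bratteli–Robinson II §5.2.2. [folklore] -/
theorem fockRelabel_map_star (π : Equiv.Perm ι) :
    ((fockRelabel π).val).map star = (fockRelabel π).val := by
  ext s t
  rw [Matrix.map_apply, fockRelabel_apply]
  split_ifs
  · exact star_relabelSign _ _
  · exact star_zero _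

variable {Λ : Type*}

/-- The spin exchange `(x, σ) ↦ (x, 1 - σ)` is an involution. [folklore] -/
theorem spinSwap_spinSwap (o : Orb Λ) :
    (Orb.spinSwap : Orb Λ ≃ Orb Λ) ((Orb.spinSwap : Orb Λ ≃ Orb Λ) o) = o := by
  obtain ⟨⟨x, σ⟩, rfl⟩ := toLex.surjective o
  change (Orb.spinSwap : Orb Λ ≃ Orb Λ) ((Orb.spinSwap : Orb Λ ≃ Orb Λ) (orb x σ)) = orb x σ
  rw [Orb.spinSwap_orb, Orb.spinSwap_orb, Equiv.swap_apply_self]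

/-- `spinSwap ∘ spinSwap = id` as a permutation of the orbitals. [folklore] -/
theorem spinSwap_trans_spinSwap :
    (Orb.spinSwap : Orb Λ ≃ Orb Λ).trans Orb.spinSwap = Equiv.refl _ :=
  Equiv.ext fun o => spinSwap_spinSwap o

variable [LinearOrder Λ] [Fintype Λ]

/-- `F² = 1` for the spin-exchange unitary `F = fockRelabel Orb.spinSwap` (`fockRelabel` is
multiplicative and `spinSwap² = id`). Lieb, PRL 62 (1989) 1201, eq. (2). [folklore] -/
theorem fockRelabel_spinSwap_mul_self :
    (fockRelabel (Orb.spinSwap : Orb Λ ≃ Orb Λ)).val *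
        (fockRelabel (Orb.spinSwap : Orb Λ ≃ Orb Λ)).val = 1 := by
  rw [fockRelabel_val, ← relabelMatrix_trans, spinSwap_trans_spinSwap, relabelMatrix_refl]

/-- **`T = F ∘ K` is an involution**: `F conj(F conj v) = v` for the spin-exchange unitary `F`
(`F` is real, so `K F = F K`, and `F² = 1`); this is `T² = +1` of the antiunitary symmetry of
the spin-twisted Hubbard torus. Hatsugai, J. Phys. Soc. Jpn. 75 (2006) 123601. [folklore] -/
theorem fockRelabel_spinSwap_mulVec_star_mulVec_star (v : Fock (Orb Λ)) :
    (fockRelabel (Orb.spinSwap : Orb Λ ≃ Orb Λ)).val *ᵥ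
        star ((fockRelabel (Orb.spinSwap : Orb Λ ≃ Orb Λ)).val *ᵥ star v) = v := by
  rw [star_mulVec_eq_map_star_mulVec, fockRelabel_map_star, star_star, mulVec_mulVec,
    fockRelabel_spinSwap_mul_self, one_mulVec]

end Involution

/-! ### The stub: the spin-twisted Hubbard torus is an instance of the abstract theorem -/

section Stub

/-- **`stub_moebiusModel`** (line `birth` of crux `NodalDiracWeakCoupling`). The abstract
Longuet-Higgins theorem `habs` (= `stub_moebiusAbstract`, verbatim) implies the Möbius sign
theorem for `H_L(U, φ) = spinTwistedHubbardTorus L U φ` on the sector `K = szSector N 0`: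
`H` is Hermitian (`spinTwistedHubbardTorus_isHermitian`) and preserves the sector
(`spinTwistedHubbardTorus_mulVec_mem_szSector`); existence of sector ground states and the
variational bound come from `sector_groundState` (coordinate sector `mem_szSector_zero_iff_coord`;
an empty sector makes the two-fold hypothesis absurd); `T v = F v̄`, `F = fockRelabel Orb.spinSwap`,
is conjugate-linear, additive, an involution (`fockRelabel_spinSwap_mulVec_star_mulVec_star`),
sector preserving, commutes with `H_L(U, φ)` (`fockRelabel_spinSwap_mulVec_star_mulVec`) and
preserves inner products up to conjugation; the first-order data `V, C` with the form bound and
the Taylor bound are `spinTwistedHubbardTorus_firstOrder`. Hatsugai, J. Phys. Soc. Jpn. 75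
(2006) 123601; Lieb, PRL 62 (1989) 1201. [folklore] -/
theorem stub_moebiusModel
    (habs : ∀ (ι : Type) [Fintype ι] [DecidableEq ι] (K : Submodule ℂ (ι → ℂ))
      (H : (Fin 2 → ℝ) → Matrix ι ι ℂ),
      (∀ φ, (H φ).IsHermitian) → (∀ φ, ∀ v ∈ K, H φ *ᵥ v ∈ K) →
      (∀ φ, ∀ v ∈ K, star v ⬝ᵥ v = 1 → (H φ).minEnergyOn K ≤ (star v ⬝ᵥ H φ *ᵥ v).re) →
      (∀ φ, ∃ v ∈ K, v ≠ 0 ∧ H φ *ᵥ v = (((H φ).minEnergyOn K : ℝ) : ℂ) • v) →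
      ∀ (T : (ι → ℂ) → (ι → ℂ)), (∀ (c : ℂ) (v : ι → ℂ), T (c • v) = star c • T v) →
      (∀ u v : ι → ℂ, T (u + v) = T u + T v) → (∀ v : ι → ℂ, T (T v) = v) →
      (∀ v ∈ K, T v ∈ K) → (∀ (φ : Fin 2 → ℝ) (v : ι → ℂ), T (H φ *ᵥ v) = H φ *ᵥ T v) →
      (∀ u v : ι → ℂ, star (T u) ⬝ᵥ T v = star (star u ⬝ᵥ v)) →
      ∀ (p : Fin 2 → ℝ) (V : Fin 2 → Matrix ι ι ℂ) (C : ℝ),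
      (∀ (μ : Fin 2) (x w : ι → ℂ), star x ⬝ᵥ x = 1 → star w ⬝ᵥ w = 1 →
        ‖star x ⬝ᵥ (V μ *ᵥ w)‖ ≤ C) →
      (∀ ε : ℝ, 0 < ε → ∃ δ : ℝ, 0 < δ ∧ ∀ y : Fin 2 → ℝ,
        Real.sqrt (y 0 ^ 2 + y 1 ^ 2) ≤ δ → ∀ x w : ι → ℂ, star x ⬝ᵥ x = 1 → star w ⬝ᵥ w = 1 →
          ‖star x ⬝ᵥ ((H (fun ν => p ν + y ν) - H p -
              (((y 0 : ℝ) : ℂ) • V 0 + ((y 1 : ℝ) : ℂ) • V 1)) *ᵥ w)‖ ≤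
            ε * Real.sqrt (y 0 ^ 2 + y 1 ^ 2)) →
      (∃ ψ₁ ψ₂ : ι → ℂ,
        (ψ₁ ∈ K ∧ ψ₁ ≠ 0 ∧ H p *ᵥ ψ₁ = (((H p).minEnergyOn K : ℝ) : ℂ) • ψ₁) ∧
        (ψ₂ ∈ K ∧ ψ₂ ≠ 0 ∧ H p *ᵥ ψ₂ = (((H p).minEnergyOn K : ℝ) : ℂ) • ψ₂) ∧
        star ψ₁ ⬝ᵥ ψ₂ = 0 ∧
        ∀ χ : ι → ℂ, (χ ∈ K ∧ χ ≠ 0 ∧ H p *ᵥ χ = (((H p).minEnergyOn K : ℝ) : ℂ) • χ) →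
          ∃ z₁ z₂ : ℂ, χ = z₁ • ψ₁ + z₂ • ψ₂) →
      (∃ m : ℝ, 0 < m ∧ ∃ ρ : ℝ, 0 < ρ ∧ ∀ φ : Fin 2 → ℝ,
        0 < (φ 0 - p 0) ^ 2 + (φ 1 - p 1) ^ 2 → (φ 0 - p 0) ^ 2 + (φ 1 - p 1) ^ 2 ≤ ρ ^ 2 →
        ∀ ψ χ : ι → ℂ, (ψ ∈ K ∧ ψ ≠ 0 ∧ H φ *ᵥ ψ = (((H φ).minEnergyOn K : ℝ) : ℂ) • ψ) →
          χ ∈ K → star ψ ⬝ᵥ χ = 0 → star χ ⬝ᵥ χ = 1 →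
            (H φ).minEnergyOn K + m * Real.sqrt ((φ 0 - p 0) ^ 2 + (φ 1 - p 1) ^ 2) ≤
              (star χ ⬝ᵥ (H φ *ᵥ χ)).re) →
      ∃ r₀ : ℝ, 0 < r₀ ∧ ∀ r : ℝ, 0 < r → r ≤ r₀ →
        ∃ n₀ : ℕ, ∀ n ≥ n₀, ∀ ψ : Fin n → ι → ℂ,
          (∀ i : Fin n,
            ((ψ i) ∈ K ∧ ψ i ≠ 0 ∧
              H (fun ν : Fin 2 => p ν + r *
                  (if ν = 0 then Real.cos (2 * Real.pi * (i : ℕ) / n)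
                    else Real.sin (2 * Real.pi * (i : ℕ) / n))) *ᵥ ψ i =
                (((H (fun ν : Fin 2 => p ν + r *
                  (if ν = 0 then Real.cos (2 * Real.pi * (i : ℕ) / n)
                    else Real.sin (2 * Real.pi * (i : ℕ) / n)))).minEnergyOn K : ℝ) : ℂ) • ψ i) ∧
            star (ψ i) ⬝ᵥ ψ i = 1) →
          (∏ i : Fin n, star (ψ i) ⬝ᵥ ψ (finRotate n i)).re < 0) :
    ∀ (L : ℕ) [NeZero L] (U : ℝ) (N : ℕ) (p : Fin 2 → ℝ),
      (∃ ψ₁ ψ₂ : Fock (Orb (FermionTorus 2 L)),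
          IsGroundStateInSector (spinTwistedHubbardTorus L U p) N 0 ψ₁ ∧
          IsGroundStateInSector (spinTwistedHubbardTorus L U p) N 0 ψ₂ ∧
          star ψ₁ ⬝ᵥ ψ₂ = 0 ∧
          ∀ χ : Fock (Orb (FermionTorus 2 L)),
            IsGroundStateInSector (spinTwistedHubbardTorus L U p) N 0 χ →
              ∃ z₁ z₂ : ℂ, χ = z₁ • ψ₁ + z₂ • ψ₂) →
      (∃ m : ℝ, 0 < m ∧ ∃ ρ : ℝ, 0 < ρ ∧ ∀ φ : Fin 2 → ℝ,
          0 < (φ 0 - p 0) ^ 2 + (φ 1 - p 1) ^ 2 →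
          (φ 0 - p 0) ^ 2 + (φ 1 - p 1) ^ 2 ≤ ρ ^ 2 →
          ∀ ψ χ : Fock (Orb (FermionTorus 2 L)),
            IsGroundStateInSector (spinTwistedHubbardTorus L U φ) N 0 ψ →
            χ ∈ szSector N 0 → star ψ ⬝ᵥ χ = 0 → star χ ⬝ᵥ χ = 1 →
              Matrix.minEnergyOn (spinTwistedHubbardTorus L U φ) (szSector N 0) +
                  m * Real.sqrt ((φ 0 - p 0) ^ 2 + (φ 1 - p 1) ^ 2) ≤
                (star χ ⬝ᵥ (spinTwistedHubbardTorus L U φ *ᵥ χ)).re) →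
      ∃ r₀ : ℝ, 0 < r₀ ∧ ∀ r : ℝ, 0 < r → r ≤ r₀ →
        ∃ n₀ : ℕ, ∀ n ≥ n₀, ∀ ψ : Fin n → Fock (Orb (FermionTorus 2 L)),
          (∀ i : Fin n,
            IsGroundStateInSector (spinTwistedHubbardTorus L U
                (fun ν : Fin 2 => p ν + r *
                      (if ν = 0 then Real.cos (2 * Real.pi * (i : ℕ) / n)
                        else Real.sin (2 * Real.pi * (i : ℕ) / n)))) N 0 (ψ i) ∧
              star (ψ i) ⬝ᵥ ψ i = 1) →
          (∏ i : Fin n, star (ψ i) ⬝ᵥ ψ (finRotate n i)).re < 0 := by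
  intro L _ U N p h2 hcone
  classical
  by_cases hp : ∃ s : Finset (Orb (FermionTorus 2 L)),
      s.card = N ∧ (upPart s).card = (downPart s).card
  · have hsg := fun φ : Fin 2 → ℝ => sector_groundState (spinTwistedHubbardTorus L U φ)
      (spinTwistedHubbardTorus_isHermitian L U φ)
      (fun s : Finset (Orb (FermionTorus 2 L)) => s.card = N ∧ (upPart s).card = (downPart s).card)
      hp (fun s s' hs hs' => spinTwistedHubbardTorus_apply_eq_zero L U φ N s s' hs hs')
      (szSector N 0) (mem_szSector_zero_iff_coord N)
    set F := (fockRelabel (Orb.spinSwap : Orb (FermionTorus 2 L) ≃ Orb (FermionTorus 2 L))).val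
      with hF
    have hTs : ∀ (c : ℂ) (v : Fock (Orb (FermionTorus 2 L))),
        F *ᵥ star (c • v) = star c • (F *ᵥ star v) := fun c v => by
      rw [star_smul, mulVec_smul]
    have hTadd : ∀ u v : Fock (Orb (FermionTorus 2 L)),
        F *ᵥ star (u + v) = F *ᵥ star u + F *ᵥ star v := fun u v => by
      rw [star_add, mulVec_add]
    have hTT : ∀ v : Fock (Orb (FermionTorus 2 L)), F *ᵥ star (F *ᵥ star v) = v := fun v => by
      rw [hF]
      exact fockRelabel_spinSwap_mulVec_star_mulVec_star v
    have hTK : ∀ v ∈ szSector N (0 : ℝ), F *ᵥ star v ∈ szSector N (0 : ℝ) := fun v hv =>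
      fockRelabel_spinSwap_mulVec_mem_szSector
        (Summit.HubbardSuperconductivity.HubbardSuperconductivity.Theorems.NodalDiracTwist.star_mem_szSector
          hv)
    have hTH : ∀ (φ : Fin 2 → ℝ) (v : Fock (Orb (FermionTorus 2 L))),
        F *ᵥ star (spinTwistedHubbardTorus L U φ *ᵥ v) =
          spinTwistedHubbardTorus L U φ *ᵥ (F *ᵥ star v) := fun φ v =>
      fockRelabel_spinSwap_mulVec_star_mulVec L U φ v
    have hTd : ∀ u v : Fock (Orb (FermionTorus 2 L)),
        star (F *ᵥ star u) ⬝ᵥ (F *ᵥ star v) = star (star u ⬝ᵥ v) := fun u v => by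
      rw [hF, star_fockRelabel_mulVec_dotProduct_fockRelabel_mulVec, star_star, dotProduct_star,
        dotProduct_comm]
    obtain ⟨V, C, hCV, hT⟩ := spinTwistedHubbardTorus_firstOrder L U p
    exact habs _ (szSector N 0) (spinTwistedHubbardTorus L U)
      (spinTwistedHubbardTorus_isHermitian L U)
      (fun φ v hv => spinTwistedHubbardTorus_mulVec_mem_szSector L U φ hv)
      (fun φ => (hsg φ).2) (fun φ => (hsg φ).1) (fun v => F *ᵥ star v) hTs hTadd hTT hTK hTH hTd
      p V C hCV hT h2 hcone
  · -- the sector is empty: there are no ground states at all, the two-fold hypothesis is absurd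
    obtain ⟨ψ₁, -, ⟨hmem, hne, -⟩, -⟩ := h2
    exact (hne (funext fun s =>
      (mem_szSector_zero_iff_coord N _).1 hmem s fun h => hp ⟨s, h⟩)).elim

end Stub

end Summit.HubbardSuperconductivity.HubbardSuperconductivity.Theorems.NodalDiracTwist

end
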